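import Summits.Ventures.CertifiedArithmetic.LowPrec.DoubleRoundingMatrix

/-!
# Theorem D-dr, clause (T), for every pair of format records: the threshold is sufficient

HONEST FRAMING (venture CertifiedArithmetic / cell `pub-lowprec`): certified error envelopes and
provably optimal rounding/accumulation schemes for low-precision formats under stated cost models;
every table by two implementations; no hardware or vendor claims.

`DRAdd X Y` (`DoubleRoundingDecision.lean`): for all finite data `a, b` of `X`,
`fl_X (fl_Y (a + b)) = fl_X (a + b)` as values (saturating round-to-nearest-even twice). THEOREM
D-dr (`DoubleRoundingMatrix.lean`) decides it on the 13 named records; its clause (T) — the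
SATURATION-AWARE THRESHOLD `drThreshold X Y` (`2^q₁ + 1` if `q₁ ≤ 2P - 1`, else
`2^(2P) + 2^(P+1)`, `q₁ = max q (P + 2)`, `P = P_X`, `q = P_Y`) — was certified there cell by cell
(kernel exhaustion of the FP4 / FP6 sources) and, for arbitrary records, was implementation A's
exhaustively verified law (`DOUBLE-ROUNDING.md` §4, `P ≤ 7`). THIS FILE proves the sufficiency
half for EVERY pair of records: `drAdd_of_lt_threshold` — if `F_X ⊆ F_Y` (`embedsTest`),
`P_X ≥ 2`, `P_X < P_Y` and `M_X < drThreshold X Y` (`M_X = maxScaled X`, the largest magnitude in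
quanta) then `DRAdd X Y`. (Necessity — a failing pair whenever `drThreshold X Y ≤ M_X` and
`P_Y ≤ 2 P_X` — is `DoubleRoundingThresholdWitness.lean`.)

PROOF (value level, no enumeration). A sum of two `X`-data is `t = n · quantum X`, `n ∈ ℤ`; by
the symmetry `fl(-t) = -fl(t)` take `n ≥ 0`.
* `n ≥ M_X`: both sides saturate to `maxRat X`, a value of `Y` (`toRat_roundNE_roundNE_of_maxRat_le`).
* `n ≤ 2^q`: `t` is a value of `Y` (EMBEDDED MULTIPLES `exists_toRat_eq_natMul_of_dvd`: a multiple
  of `2^g` of at most `q + g` bits within the range of `X` is a value of `Y`), so `fl_Y t = t`.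
* `2^q < n < M_X < drThreshold`: unfolding the threshold (and, in its second branch, THE GRID ABOVE
  A POWER OF TWO `pow_add_pow_le_of_representable`: a value of `X` above `2^(2P)` quanta is at least
  `2^(2P) + 2^(P+1)`, so `M_X < 2^(2P) + 2^(P+1)` forces `M_X ≤ 2^(2P)`) leaves exactly one
  configuration: `q = P + 1` and `2^(P+1) < n < 2^(P+2)`, `n + 1 ≤ M_X` — the binade of `X` with
  spacing `4` quanta, where `Y` has spacing `2`. Even `n` is a value of `Y`. Odd `n` is THE TIE
  (`toRat_roundNE_roundNE_of_odd`): its `Y`-neighbours `n ± 1` are values of `Y` two `X`-quanta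
  apart with no value of `Y` between (successor gap `MiniFloat.add_ulp_le_of_lt`), so `fl_Y t` is
  one of them (`toRat_roundNE_tie_or`) and, the other being equidistant, has an EVEN trailing
  significand (`roundNE_man_even_of_tie`), which in this binade of `Y` means `4 ∣ n ± 1`
  (`four_dvd_of_roundNE_tie`); that neighbour is a value of `X`, so the double rounding returns it;
  and it is also `fl_X t`: the unique value of `X` within one quantum of `t` (values of `X` there
  are multiples of `4`, `MiniFloat.toRat_roundNE_eq_of_forall_lt`).
No hypothesis `P_Y ≤ 2 P_X` is needed for sufficiency (for `P_Y ≥ 2 P_X + 1` the threshold test is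
merely weaker than clause (W)). TWO IMPLEMENTATIONS: A = `code/enum/doubleround_decision.py`
(the same law by brute force over all operand pairs for `P ≤ 7` and on the 45 FP4/FP6-source
cells); B = this file (a proof for all records). PLACEMENT: the unbounded-range statements
[Figueroa1995, §2; Rump2016, Lemma 4.4; Roux2014] have no threshold (there clause (T) is empty);
no finite-range threshold law was found in the held corpus or the galaxy corpora
(`DOUBLE-ROUNDING.md` §5).
-/

namespace Summit.Ventures.CertifiedArithmetic

open Literature.ComputerArithmetic.FloatingPoint
open Literature.ComputerArithmetic.FloatingPoint.Format
open Literature.ComputerArithmetic.FloatingPoint.MiniFloat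

/-! ## §1 Integer lemmas: the grid above a power of two, embedded multiples, ulp size -/

/-- THE GRID ABOVE A POWER OF TWO: a representable magnitude strictly above `2^(P + s)` quanta is
at least `2^(P + s) + 2^(s + 1)` (the spacing of the `P`-bit grid in that binade). -/
theorem pow_add_pow_le_of_representable {φ : Format} {n s : ℕ} (hn : φ.Representable n)
    (hlt : 2 ^ (φ.manBits + 1 + s) < n) : 2 ^ (φ.manBits + 1 + s) + 2 ^ (s + 1) ≤ n := by
  have h1 : 2 ^ (φ.manBits + (s + 1)) ≤ n := by
    rw [show φ.manBits + (s + 1) = φ.manBits + 1 + s by ring]; exact hlt.le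
  obtain ⟨a, ha⟩ := pow_dvd_of_representable hn h1
  have hb : 2 ^ (φ.manBits + 1 + s) = 2 ^ (s + 1) * 2 ^ φ.manBits := by rw [← pow_add]; ring_nf
  rw [ha, hb] at hlt ⊢
  have ha' : 2 ^ φ.manBits < a := Nat.lt_of_mul_lt_mul_left hlt
  calc 2 ^ (s + 1) * 2 ^ φ.manBits + 2 ^ (s + 1) = 2 ^ (s + 1) * (2 ^ φ.manBits + 1) := by ring
    _ ≤ 2 ^ (s + 1) * a := Nat.mul_le_mul_left _ ha'

/-- EMBEDDED MULTIPLES: under the quantum and range clauses of `embedsTest φ ψ`, a multiple `n` of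
`2^g` (in quanta of `φ`) of at most `P_ψ + g` bits and within the range of `φ` is a value of `ψ`. -/
theorem exists_toRat_eq_natMul_of_dvd {φ ψ : Format} (hq : ψ.qexp ≤ φ.qexp)
    (hM : φ.maxScaled * 2 ^ (φ.qexp - ψ.qexp).toNat ≤ ψ.maxScaled) {g n : ℕ} (hd : 2 ^ g ∣ n)
    (hle : n ≤ 2 ^ (ψ.manBits + 1 + g)) (hmax : n ≤ φ.maxScaled) :
    ∃ z : MiniFloat ψ, z.toRat = (n : ℚ) * φ.quantum := by
  set d := (φ.qexp - ψ.qexp).toNat with hd_def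
  have hrep : ψ.Representable (n * 2 ^ d) := by
    refine representable_of_pow_dvd (g := g + d) ?_ ?_ (le_trans (Nat.mul_le_mul_right _ hmax) hM)
    · rw [pow_add]; exact Nat.mul_dvd_mul hd dvd_rfl
    · calc n * 2 ^ d ≤ 2 ^ (ψ.manBits + 1 + g) * 2 ^ d := Nat.mul_le_mul_right _ hle
        _ = 2 ^ (ψ.manBits + 1 + (g + d)) := by rw [← pow_add]; ring_nf
  obtain ⟨z, hz⟩ := exists_toRat_eq_intCast_mul (φ := ψ) ((n * 2 ^ d : ℕ) : ℤ)
    (by rw [Int.natAbs_natCast]; exact hrep)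
  refine ⟨z, ?_⟩
  rw [hz, quantum_eq_two_pow_mul hq]
  push_cast; ring

/-- The largest value of `φ` is a value of `ψ` when the embedding test passes. -/
theorem exists_toRat_eq_maxRat_of_test {φ ψ : Format} (hE : embedsTest φ ψ = true) :
    ∃ z : MiniFloat ψ, z.toRat = φ.maxRat := by
  obtain ⟨z, hz⟩ := embeds_of_test hE (MiniFloat.top φ)
  exact ⟨z, hz.trans toRat_top⟩

/-- ULP SIZE: a datum of magnitude at least `2^(P + k)` quanta has ulp at least `2^(k + 1)` quanta. -/
theorem succ_le_ulpExp_of_le_scaledMag {ψ : Format} {z : MiniFloat ψ} {k : ℕ}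
    (h : 2 ^ (ψ.manBits + 1 + k) ≤ z.scaledMag) : k + 1 ≤ z.expCode - 1 := by
  have h1 := lt_of_le_of_lt h (scaledMag_lt_pow_ulpExp z)
  have h2 := (Nat.pow_lt_pow_iff_right (by norm_num)).mp h1
  omega

/-! ## §2 The tie: `q = P + 1`, an odd multiple in the binade of spacing four -/

/-- GAP IN `ψ`: if `L · quantum φ` is a value of `ψ` with `L ≥ 2^(P_ψ)`, no value of `ψ` lies
strictly between `L` and `L + 2` quanta of `φ` (the ulp of `ψ` there is at least two quanta of
`φ`). -/
theorem gap_of_tie {φ ψ : Format} (hq : ψ.qexp ≤ φ.qexp) {L : ℕ} {zL : MiniFloat ψ}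
    (hzL : zL.toRat = (L : ℚ) * φ.quantum) (hL : 2 ^ (ψ.manBits + 1) ≤ L) (y : MiniFloat ψ) :
    y.toRat ≤ (L : ℚ) * φ.quantum ∨ ((L : ℚ) + 2) * φ.quantum ≤ y.toRat := by
  rcases le_or_gt y.toRat ((L : ℚ) * φ.quantum) with h | h
  · exact Or.inl h
  right
  have hqφ := φ.quantum_pos
  have hqψ := ψ.quantum_pos
  have hquant := quantum_eq_two_pow_mul hq
  set d := (φ.qexp - ψ.qexp).toNat with hd_def
  have hz0 : 0 ≤ zL.toRat := by rw [hzL]; exact mul_nonneg (Nat.cast_nonneg _) hqφ.le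
  have hS : zL.scaledMag = L * 2 ^ d :=
    scaledMag_eq_of_toRat_eq (by rw [hzL, hquant]; push_cast; ring)
  have he : d + 1 ≤ zL.expCode - 1 :=
    succ_le_ulpExp_of_le_scaledMag (k := d) (by rw [hS, pow_add]; exact Nat.mul_le_mul_right _ hL)
  have h1 := add_ulp_le_of_lt (y := y) hz0 (by rw [hzL]; exact h)
  have h2 : (2 : ℚ) ^ (d + 1) ≤ 2 ^ (zL.expCode - 1) := pow_le_pow_right₀ (by norm_num) he
  calc ((L : ℚ) + 2) * φ.quantum = zL.toRat + 2 ^ (d + 1) * ψ.quantum := by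
        rw [hzL, hquant]; ring
    _ ≤ zL.toRat + 2 ^ (zL.expCode - 1) * ψ.quantum := by nlinarith
    _ ≤ y.toRat := h1

/-- THE INTERMEDIATE ROUNDING OF A TIE IS A NEIGHBOUR: with `L` as in `gap_of_tie`,
`fl_ψ ((L + 1) · quantum φ)` is `L` or `L + 2` quanta of `φ`. -/
theorem toRat_roundNE_tie_or {φ ψ : Format} (hq : ψ.qexp ≤ φ.qexp) {L : ℕ} {zL : MiniFloat ψ}
    (hzL : zL.toRat = (L : ℚ) * φ.quantum) (hL : 2 ^ (ψ.manBits + 1) ≤ L) :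
    (roundNE ψ (((L : ℚ) + 1) * φ.quantum)).toRat = (L : ℚ) * φ.quantum ∨
      (roundNE ψ (((L : ℚ) + 1) * φ.quantum)).toRat = ((L : ℚ) + 2) * φ.quantum := by
  have hqφ := φ.quantum_pos
  have hnear := roundNE_nearest (φ := ψ) (((L : ℚ) + 1) * φ.quantum) zL
  rw [hzL, show ((L : ℚ) + 1) * φ.quantum - (L : ℚ) * φ.quantum = φ.quantum by ring,
    abs_of_pos hqφ] at hnear
  rcases gap_of_tie hq hzL hL (roundNE ψ (((L : ℚ) + 1) * φ.quantum)) with h | h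
  · left
    rw [abs_of_nonneg (by linarith)] at hnear
    linarith
  · right
    rw [abs_of_nonpos (by linarith)] at hnear
    linarith

/-- THE TIE RULE READ IN QUANTA OF `φ`: if `fl_ψ x` has the value `K · quantum φ` with
`K ≥ 2^(P_ψ)` and some other value of `ψ` is equidistant from `x`, then `4 ∣ K` (the trailing
significand of `fl_ψ x` is even, and its ulp is at least two quanta of `φ`). -/
theorem four_dvd_of_roundNE_tie {φ ψ : Format} (h1 : 1 ≤ ψ.manBits) (hq : ψ.qexp ≤ φ.qexp)
    {K : ℕ} {x : ℚ} {y : MiniFloat ψ} (hK : (roundNE ψ x).toRat = (K : ℚ) * φ.quantum)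
    (hKlo : 2 ^ (ψ.manBits + 1) ≤ K) (heq : |x - y.toRat| = |x - (roundNE ψ x).toRat|)
    (hne : y.toRat ≠ (roundNE ψ x).toRat) : 4 ∣ K := by
  have hquant := quantum_eq_two_pow_mul hq
  set d := (φ.qexp - ψ.qexp).toNat with hd_def
  have hev := roundNE_man_even_of_tie h1 heq hne
  rw [two_dvd_man_iff h1] at hev
  have hS : (roundNE ψ x).scaledMag = K * 2 ^ d :=
    scaledMag_eq_of_toRat_eq (by rw [hK, hquant]; push_cast; ring)
  have he : d + 1 ≤ (roundNE ψ x).expCode - 1 :=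
    succ_le_ulpExp_of_le_scaledMag (k := d) (by rw [hS, pow_add]; exact Nat.mul_le_mul_right _ hKlo)
  rw [hS] at hev
  obtain ⟨t, ht⟩ := Nat.exists_eq_add_of_le he
  have h3 : 2 ^ (d + 2) ∣ K * 2 ^ d := by
    refine dvd_trans ⟨2 ^ t, ?_⟩ hev
    rw [ht]; ring
  obtain ⟨c, hc⟩ := h3
  have h4 : K * 2 ^ d = 4 * c * 2 ^ d := by rw [hc]; ring
  exact ⟨c, Nat.eq_of_mul_eq_mul_right (by positivity) h4⟩

/-- THE TIE: for `P_ψ = P_φ + 1` and an odd `n` with `2^(P+1) < n < 2^(P+2)`, `n + 1 ≤ M_φ`,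
the multiple `n · quantum φ` double-rounds correctly: `fl_ψ` delivers the neighbour `n ± 1`
divisible by `4`, which is a value of `φ` and the unique value of `φ` within one quantum. -/
theorem toRat_roundNE_roundNE_of_odd {φ ψ : Format} (hm' : ψ.manBits = φ.manBits + 1)
    (hq : ψ.qexp ≤ φ.qexp) (hM : φ.maxScaled * 2 ^ (φ.qexp - ψ.qexp).toNat ≤ ψ.maxScaled)
    {n : ℕ} (hodd : n % 2 = 1) (hlo : 2 ^ (φ.manBits + 2) < n) (hhi : n < 2 ^ (φ.manBits + 3))
    (hmax : n + 1 ≤ φ.maxScaled) :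
    (roundNE φ (roundNE ψ ((n : ℚ) * φ.quantum)).toRat).toRat
      = (roundNE φ ((n : ℚ) * φ.quantum)).toRat := by
  have hqφ := φ.quantum_pos
  have h1ψ : 1 ≤ ψ.manBits := by omega
  have hpow2 : 2 ^ (φ.manBits + 2) = 2 ^ (ψ.manBits + 1) := by rw [hm']
  have hpow3 : 2 ^ (φ.manBits + 3) = 2 ^ (ψ.manBits + 1 + 1) := by rw [hm']
  have hpow3' : 2 ^ (φ.manBits + 3) = 2 ^ (φ.manBits + 1 + 2) := by ring_nf
  obtain ⟨L, rfl⟩ : ∃ L, n = L + 1 := ⟨n - 1, by omega⟩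
  push_cast
  have hLlo : 2 ^ (ψ.manBits + 1) ≤ L := by rw [← hpow2]; omega
  -- the two neighbours are values of `ψ`
  obtain ⟨zL, hzL⟩ := exists_toRat_eq_natMul_of_dvd hq hM (g := 1) (n := L)
    (by rw [pow_one]; exact Nat.dvd_of_mod_eq_zero (by omega)) (by rw [← hpow3]; omega) (by omega)
  obtain ⟨zU, hzU⟩ := exists_toRat_eq_natMul_of_dvd hq hM (g := 1) (n := L + 2)
    (by rw [pow_one]; exact Nat.dvd_of_mod_eq_zero (by omega)) (by rw [← hpow3]; omega) (by omega)
  push_cast at hzU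
  -- `fl_ψ` is one of them, `K` quanta of `φ`
  obtain ⟨K, hK, hKmem⟩ : ∃ K : ℕ, (roundNE ψ (((L : ℚ) + 1) * φ.quantum)).toRat
      = (K : ℚ) * φ.quantum ∧ (K = L ∨ K = L + 2) := by
    rcases toRat_roundNE_tie_or hq hzL hLlo with h | h
    · exact ⟨L, h, Or.inl rfl⟩
    · exact ⟨L + 2, by rw [h]; push_cast; ring, Or.inr rfl⟩
  have hKlo : 2 ^ (ψ.manBits + 1) ≤ K := by rcases hKmem with rfl | rfl <;> omega
  -- distances of the two neighbours
  have eL : ((L : ℚ) + 1) * φ.quantum - (L : ℚ) * φ.quantum = φ.quantum := by ring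
  have eU : ((L : ℚ) + 1) * φ.quantum - ((L : ℚ) + 2) * φ.quantum = -φ.quantum := by ring
  have eK : |((L : ℚ) + 1) * φ.quantum - (K : ℚ) * φ.quantum| = φ.quantum := by
    rcases hKmem with rfl | rfl
    · rw [eL, abs_of_pos hqφ]
    · push_cast; rw [eU, abs_neg, abs_of_pos hqφ]
  -- the tie rule: `4 ∣ K`
  have h4 : 4 ∣ K := by
    rcases hKmem with rfl | rfl
    · refine four_dvd_of_roundNE_tie h1ψ hq hK hKlo (y := zU) ?_ ?_
      · rw [hK, hzU, eU, eL, abs_neg]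
      · rw [hK, hzU]; intro h; have := mul_right_cancel₀ hqφ.ne' h; linarith
    · refine four_dvd_of_roundNE_tie h1ψ hq hK hKlo (y := zL) ?_ ?_
      · rw [hK, hzL, eL]; push_cast; rw [eU, abs_neg]
      · rw [hK, hzL]; push_cast; intro h; have := mul_right_cancel₀ hqφ.ne' h; linarith
  -- `K` is a value of `φ`
  have hKφ : ∃ yK : MiniFloat φ, yK.toRat = (K : ℚ) * φ.quantum := by
    have hrep : φ.Representable K := by
      refine representable_of_pow_dvd (g := 2) (by norm_num; exact h4) ?_ ?_
      · rw [← hpow3']; rcases hKmem with rfl | rfl <;> omega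
      · rcases hKmem with rfl | rfl <;> omega
    obtain ⟨y, hy⟩ := exists_toRat_eq_intCast_mul (φ := φ) (K : ℤ)
      (by rw [Int.natAbs_natCast]; exact hrep)
    exact ⟨y, by rw [hy]; push_cast; ring⟩
  -- left: the second rounding is the identity; right: unique nearest
  rw [hK, toRat_roundNE_of_exists hKφ]
  symm
  apply toRat_roundNE_eq_of_forall_lt hKφ
  intro y hy
  rw [eK, toRat_eq_toInt_mul y, ← sub_mul, abs_mul, abs_of_pos hqφ]
  by_contra hcon
  have hle : |((L : ℚ) + 1) - (y.toInt : ℚ)| ≤ 1 := by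
    by_contra h'
    push Not at h'
    exact hcon (by nlinarith [abs_nonneg (((L : ℚ) + 1) - (y.toInt : ℚ))])
  obtain ⟨hA, hB⟩ := abs_le.mp hle
  have hA' : y.toInt ≤ (L : ℤ) + 2 := by
    have : ((y.toInt : ℤ) : ℚ) ≤ (L : ℚ) + 2 := by linarith
    exact_mod_cast this
  have hB' : (L : ℤ) ≤ y.toInt := by
    have : (L : ℚ) ≤ ((y.toInt : ℤ) : ℚ) := by linarith
    exact_mod_cast this
  have hy0 : 0 ≤ y.toRat := by
    rw [toRat_eq_toInt_mul]
    exact mul_nonneg (by exact_mod_cast (by omega : (0 : ℤ) ≤ y.toInt)) hqφ.le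
  have hyS := toInt_eq_scaledMag_of_nonneg hy0
  rw [hyS] at hA' hB'
  have hsy : L ≤ y.scaledMag := by exact_mod_cast hB'
  have hsy' : y.scaledMag ≤ L + 2 := by exact_mod_cast hA'
  have h4y : 4 ∣ y.scaledMag := by
    have h := pow_dvd_of_representable (s := 2) (representable_scaledMag y)
      (by rw [hpow2]; exact le_trans hLlo hsy)
    norm_num at h
    exact h
  have hneK : y.scaledMag ≠ K := by
    intro h
    apply hy
    rw [toRat_eq_toInt_mul, hyS, h]; push_cast; ring
  have hKmem' := hKmem
  omega

/-- THE MID BINADE: for `P_ψ = P_φ + 1`, every multiple `n · quantum φ` with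
`2^(P+1) < n < 2^(P+2)`, `n + 1 ≤ M_φ` double-rounds correctly (even `n`: a value of `ψ`;
odd `n`: the tie). -/
theorem toRat_roundNE_roundNE_of_mid {φ ψ : Format} (hm' : ψ.manBits = φ.manBits + 1)
    (hq : ψ.qexp ≤ φ.qexp) (hM : φ.maxScaled * 2 ^ (φ.qexp - ψ.qexp).toNat ≤ ψ.maxScaled)
    {n : ℕ} (hlo : 2 ^ (φ.manBits + 2) < n) (hhi : n < 2 ^ (φ.manBits + 3))
    (hmax : n + 1 ≤ φ.maxScaled) :
    (roundNE φ (roundNE ψ ((n : ℚ) * φ.quantum)).toRat).toRat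
      = (roundNE φ ((n : ℚ) * φ.quantum)).toRat := by
  by_cases he : n % 2 = 0
  · apply toRat_roundNE_roundNE_of_exists
    refine exists_toRat_eq_natMul_of_dvd hq hM (g := 1) (by rw [pow_one]; exact Nat.dvd_of_mod_eq_zero he) ?_ (by omega)
    rw [hm', show φ.manBits + 1 + 1 + 1 = φ.manBits + 3 by ring]; exact hhi.le
  · exact toRat_roundNE_roundNE_of_odd hm' hq hM (by omega) hlo hhi hmax

/-! ## §3 Sufficiency of the threshold -/

/-- BELOW THE THRESHOLD, EVERY NONNEGATIVE MULTIPLE of `quantum φ` double-rounds correctly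
(`F_φ ⊆ F_ψ`, `P_φ ≥ 2`, `P_φ < P_ψ`, `M_φ < drThreshold φ ψ`). -/
theorem toRat_roundNE_roundNE_natMul_of_lt_threshold {φ ψ : Format} (hE : embedsTest φ ψ = true)
    (h1 : 1 ≤ φ.manBits) (hP : φ.manBits < ψ.manBits) (hlt : φ.maxScaled < drThreshold φ ψ)
    (n : ℕ) :
    (roundNE φ (roundNE ψ ((n : ℚ) * φ.quantum)).toRat).toRat
      = (roundNE φ ((n : ℚ) * φ.quantum)).toRat := by
  have hE' := hE
  simp only [embedsTest, Bool.and_eq_true, decide_eq_true_eq] at hE'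
  obtain ⟨⟨-, hq⟩, hM⟩ := hE'
  have hqφ := φ.quantum_pos
  -- saturation
  rcases le_or_gt φ.maxScaled n with hsat | hnM
  · exact toRat_roundNE_roundNE_of_maxRat_le (exists_toRat_eq_maxRat_of_test hE)
      (by unfold Format.maxRat; exact mul_le_mul_of_nonneg_right (by exact_mod_cast hsat) hqφ.le)
  -- at most `P_ψ` bits: a value of `ψ`
  rcases le_or_gt n (2 ^ (ψ.manBits + 1)) with hsmall | hbig
  · exact toRat_roundNE_roundNE_of_exists
      (exists_toRat_eq_natMul_of_dvd hq hM (g := 0) (one_dvd n) (by simpa using hsmall) hnM.le)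
  -- the threshold leaves only the mid binade with `P_ψ = P_φ + 1`
  have key : ψ.manBits = φ.manBits + 1 ∧ n < 2 ^ (φ.manBits + 3) := by
    unfold drThreshold drQ1 at hlt
    split at hlt
    · rename_i hc
      rcases le_or_gt (φ.manBits + 3) (ψ.manBits + 1) with h | h
      · rw [max_eq_left h] at hlt; omega
      · rw [max_eq_right h.le] at hlt
        exact ⟨by omega, by omega⟩
    · rename_i hc
      have hMle : φ.maxScaled ≤ 2 ^ (2 * φ.manBits + 2) := by
        by_contra h
        push Not at h
        have h' := pow_add_pow_le_of_representable (s := φ.manBits + 1) (representable_maxScaled φ)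
          (by rw [show φ.manBits + 1 + (φ.manBits + 1) = 2 * φ.manBits + 2 by ring]; exact h)
        rw [show φ.manBits + 1 + (φ.manBits + 1) = 2 * φ.manBits + 2 by ring,
          show φ.manBits + 1 + 1 = φ.manBits + 2 by ring] at h'
        omega
      have hlt2 : 2 ^ (ψ.manBits + 1) < 2 ^ (2 * φ.manBits + 2) := by omega
      have hm'2 := (Nat.pow_lt_pow_iff_right (by norm_num)).mp hlt2
      rcases lt_max_iff.mp (not_le.mp hc) with h | h
      · omega
      · have hm1 : φ.manBits = 1 := by omega
        have hm2 : ψ.manBits = 2 := by omega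
        refine ⟨by omega, ?_⟩
        rw [hm1] at hMle ⊢
        norm_num at hMle ⊢
        omega
  obtain ⟨hm', hhi⟩ := key
  have hlo : 2 ^ (φ.manBits + 2) < n := by rw [hm'] at hbig; exact hbig
  exact toRat_roundNE_roundNE_of_mid hm' hq hM hlo hhi (by omega)

/-- The same for every integer multiple, by `fl(-t) = -fl(t)`. -/
theorem toRat_roundNE_roundNE_intMul_of_lt_threshold {φ ψ : Format} (hE : embedsTest φ ψ = true)
    (h1 : 1 ≤ φ.manBits) (hP : φ.manBits < ψ.manBits) (hlt : φ.maxScaled < drThreshold φ ψ)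
    (N : ℤ) :
    (roundNE φ (roundNE ψ ((N : ℚ) * φ.quantum)).toRat).toRat
      = (roundNE φ ((N : ℚ) * φ.quantum)).toRat := by
  obtain ⟨n, rfl | rfl⟩ := Int.eq_nat_or_neg N
  · push_cast; exact toRat_roundNE_roundNE_natMul_of_lt_threshold hE h1 hP hlt n
  · have h := toRat_roundNE_roundNE_natMul_of_lt_threshold hE h1 hP hlt n
    push_cast
    simp only [neg_mul, toRat_roundNE_neg, h]

/-- THEOREM D-dr, CLAUSE (T), SUFFICIENCY — for EVERY pair of format records: if `F_φ ⊆ F_ψ`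
(`embedsTest`), `P_φ ≥ 2`, `P_φ < P_ψ` and `maxScaled φ < drThreshold φ ψ`, then computing any
sum of two `φ`-data in `ψ` and converting to `φ` gives the correctly rounded `φ`-sum. -/
theorem drAdd_of_lt_threshold {φ ψ : Format} (hE : embedsTest φ ψ = true) (h1 : 1 ≤ φ.manBits)
    (hP : φ.manBits < ψ.manBits) (hlt : φ.maxScaled < drThreshold φ ψ) : DRAdd φ ψ := by
  intro a b
  rw [toRat_add_toRat]
  exact toRat_roundNE_roundNE_intMul_of_lt_threshold hE h1 hP hlt _

/-- The same under the cell's standard operand hypothesis `stdOperand φ` (precision `≥ 2`). -/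
theorem drAdd_of_lt_threshold_std {φ ψ : Format} (hstd : stdOperand φ = true)
    (hE : embedsTest φ ψ = true) (hP : φ.manBits < ψ.manBits)
    (hlt : φ.maxScaled < drThreshold φ ψ) : DRAdd φ ψ := by
  simp only [stdOperand, Bool.and_eq_true, decide_eq_true_eq] at hstd
  exact drAdd_of_lt_threshold hE hstd.1 hP hlt

/-- READING: the clause-(T) cells of the named matrix now follow from the general theorem with
no operand enumeration — e2m3 through bfloat16 (`P = 4`, `q = 8 = 2P`, `60 < 288`), e2m3 through
binary8p5 (`q = 5 = P + 1`, `60 < 65`), e2m1 through e4m3 (`P = 2`, `q = 4 = 2P`, `12 < 24`). -/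
theorem drAdd_T_cells_by_threshold : DRAdd E2M3 BFloat16 ∧ DRAdd E2M3 Binary8p5 ∧ DRAdd E2M1 E4M3 :=
  ⟨drAdd_of_lt_threshold (by decide +kernel) (by decide) (by decide) (by decide +kernel),
   drAdd_of_lt_threshold (by decide +kernel) (by decide) (by decide) (by decide +kernel),
   drAdd_of_lt_threshold (by decide +kernel) (by decide) (by decide) (by decide +kernel)⟩

end Summit.Ventures.CertifiedArithmetic
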